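import Summits.NavierStokesRegularity.NavierStokesRegularity.Theses.TypeIIInviscidRelaxation
import Summits.NavierStokesRegularity.NavierStokesRegularity.Theorems.TypeIIInviscidRelaxationAxisymSwirlRegularOfSupercriticalDefectFloor
import Summits.NavierStokesRegularity.NavierStokesRegularity.Theorems.TypeIIInviscidRelaxationOneSidedRadialCriterionIffCorePartialTypeI
import HarnessLib

/-!
# Crux `AxisymSwirlRegular` (stmt-NavierStokesRegularity-1964) in its two research currencies, BY NAME

`--supports stmt-NavierStokesRegularity-1964` (leaf helper; two theorems, no definitions, no `sorry`; it imports
the two by-name certificate files and is imported by nothing).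

After the line `radial_inflow_split` (⟨1964⟩ ⟺ ⟨19059⟩ ∧ ⟨19060⟩, tree
`axisymSwirlRegular_iff_oneSidedRadialCriterion_and_aprioriRadialInflowBound`) and the two registered piece lines
`Cruxes/OneSidedRadialCriterion/Lines/parabolic_core_partial_typeI.lean` (⟨19059⟩ ⟺ CPT,
`CorePartialTypeI.oneSidedRadialCriterion_iff_corePartialTypeI`) and
`Cruxes/AprioriRadialInflowBound/Lines/supercritical_defect_floor.lean` (assembly stub landed; ⟨19060⟩ ⟺ SDF,
`aprioriRadialInflowBound_iff_supercriticalDefectFloor`), the crux reads, in kernel and by name: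

  `AxisymSwirlRegular ↔ CPT ∧ SDF`   and   `AxisymSwirlRegular ↔ CPT ∧ SDF-germ`,

CPT = partial Type I for the radial velocity inside the viscous-parabolic core under the one-sided inflow gate
(open exactly for gate constants `C ≥ 2`), SDF = the supercritical cyclostrophic-defect floor at the strongest
inflow points (open; a one-sided a-priori pressure statement). HONEST FRAMING: a re-typing certificate; both
conjuncts are open research statements; nothing is closed and nothing about Navier–Stokes regularity is claimed.
-/

noncomputable section

open Set
open Literature.Analysis.FluidPDE
open scoped Laplacian

namespace Summit.NavierStokesRegularity.NavierStokesRegularity.Theorems.CorePartialTypeI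

-- the problem directory repeats the summit name (`NavierStokesRegularity/NavierStokesRegularity`)
set_option linter.dupNamespace false

open Summit.NavierStokesRegularity.NavierStokesRegularity.Theorems
open Summit.NavierStokesRegularity.NavierStokesRegularity.Theses.TypeIIInviscidRelaxation
  (AxisymSwirlRegular OneSidedRadialCriterion AprioriRadialInflowBound)

/-- **The crux ⟨1964⟩ in its two research currencies, BY NAME:
`AxisymSwirlRegular ↔ (partial Type I for u_r in the parabolic core under the gate) ∧ (supercritical defect
floor)`.** Through the tree's tightness certificate
`axisymSwirlRegular_iff_oneSidedRadialCriterion_and_aprioriRadialInflowBound`, the equivalence above, and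
`aprioriRadialInflowBound_iff_supercriticalDefectFloor`. Both conjuncts are the research stubs of the two
registered piece lines; both are open; nothing is closed. [new] -/
theorem axisymSwirlRegular_iff_corePartialTypeI_and_supercriticalDefectFloor :
    AxisymSwirlRegular ↔
    (∀ (ν T : ℝ), 0 < ν → 0 < T →
      ∀ (u : ℝ → EuclideanSpace ℝ (Fin 3) → EuclideanSpace ℝ (Fin 3)) (p : ℝ → EuclideanSpace ℝ (Fin 3) → ℝ),
      IsClassicalNSSolutionOn (Ico 0 T) ν 0 u p → IsLerayHopfOn T ν 0 (u 0) u →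
      (∀ T' < T, ∃ M : ℝ, ∀ t ∈ Icc 0 T', ∀ x, ‖u t x‖ ≤ M) →
      (∀ t ∈ Ico 0 T, IsAxisymmetric (u t)) → HasRapidSpatialDecay (u 0) →
      (∃ C δ : ℝ, 0 < δ ∧ ∀ t ∈ Ico 0 T, ∀ x : EuclideanSpace ℝ (Fin 3), cylRadius x < δ →
        -(C * ν) ≤ x 0 * u t x 0 + x 1 * u t x 1) →
      ∃ ξ M T' : ℝ, 0 < ξ ∧ 0 < M ∧ 0 ≤ T' ∧ T' < T ∧
        ∀ t ∈ Ico T' T, ∀ x : EuclideanSpace ℝ (Fin 3), 0 < cylRadius x → cylRadius x < ξ * √(ν * (T - t)) →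
          -(M * √ν / √(T - t)) ≤ radialVelocity (u t) x) ∧
    (∀ (ν T : ℝ), 0 < ν → 0 < T →
      ∀ (u : ℝ → EuclideanSpace ℝ (Fin 3) → EuclideanSpace ℝ (Fin 3)) (p : ℝ → EuclideanSpace ℝ (Fin 3) → ℝ),
      IsClassicalNSSolutionOn (Ico 0 T) ν 0 u p → IsLerayHopfOn T ν 0 (u 0) u →
      (∀ T' < T, ∃ M : ℝ, ∀ t ∈ Icc 0 T', ∀ x, ‖u t x‖ ≤ M) →
      (∀ t ∈ Ico 0 T, IsAxisymmetric (u t)) → HasRapidSpatialDecay (u 0) →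
      ∃ (C₀ δ : ℝ) (g : ℝ → ℝ), 0 < δ ∧ ContinuousOn g (Ico 0 T) ∧ MeasureTheory.IntegrableOn g (Ico 0 T) ∧
        ∀ t ∈ Ico 0 T, ∀ x : EuclideanSpace ℝ (Fin 3), cylRadius x < δ → cylRadius x ≠ 0 →
          x 0 * u t x 0 + x 1 * u t x 1 ≤ -(C₀ * ν) →
          fderiv ℝ (fun z : EuclideanSpace ℝ (Fin 3) => z 0 * u t z 0 + z 1 * u t z 1) x = 0 →
          0 ≤ (Δ (fun z : EuclideanSpace ℝ (Fin 3) => z 0 * u t z 0 + z 1 * u t z 1)) x →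
          -g t ≤ (u t x 0) ^ 2 + (u t x 1) ^ 2
            - (x 0 * fderiv ℝ (p t) x (EuclideanSpace.single 0 1)
                + x 1 * fderiv ℝ (p t) x (EuclideanSpace.single 1 1))) := by
  rw [axisymSwirlRegular_iff_oneSidedRadialCriterion_and_aprioriRadialInflowBound,
    oneSidedRadialCriterion_iff_corePartialTypeI, aprioriRadialInflowBound_iff_supercriticalDefectFloor]

/-- **Germ form of the same, BY NAME: `AxisymSwirlRegular ↔ CPT ∧ (germ of SDF at the final time)`** —
both research statements are asked only on a final time interval `[T', T)` / `[T₁, T)` (CPT is germ-shaped by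
design; for SDF this is `aprioriRadialInflowBound_iff_supercriticalDefectFloorGerm`). Nothing is closed. [new] -/
theorem axisymSwirlRegular_iff_corePartialTypeI_and_supercriticalDefectFloorGerm :
    AxisymSwirlRegular ↔
    (∀ (ν T : ℝ), 0 < ν → 0 < T →
      ∀ (u : ℝ → EuclideanSpace ℝ (Fin 3) → EuclideanSpace ℝ (Fin 3)) (p : ℝ → EuclideanSpace ℝ (Fin 3) → ℝ),
      IsClassicalNSSolutionOn (Ico 0 T) ν 0 u p → IsLerayHopfOn T ν 0 (u 0) u →
      (∀ T' < T, ∃ M : ℝ, ∀ t ∈ Icc 0 T', ∀ x, ‖u t x‖ ≤ M) →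
      (∀ t ∈ Ico 0 T, IsAxisymmetric (u t)) → HasRapidSpatialDecay (u 0) →
      (∃ C δ : ℝ, 0 < δ ∧ ∀ t ∈ Ico 0 T, ∀ x : EuclideanSpace ℝ (Fin 3), cylRadius x < δ →
        -(C * ν) ≤ x 0 * u t x 0 + x 1 * u t x 1) →
      ∃ ξ M T' : ℝ, 0 < ξ ∧ 0 < M ∧ 0 ≤ T' ∧ T' < T ∧
        ∀ t ∈ Ico T' T, ∀ x : EuclideanSpace ℝ (Fin 3), 0 < cylRadius x → cylRadius x < ξ * √(ν * (T - t)) →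
          -(M * √ν / √(T - t)) ≤ radialVelocity (u t) x) ∧
    (∀ (ν T : ℝ), 0 < ν → 0 < T →
      ∀ (u : ℝ → EuclideanSpace ℝ (Fin 3) → EuclideanSpace ℝ (Fin 3)) (p : ℝ → EuclideanSpace ℝ (Fin 3) → ℝ),
      IsClassicalNSSolutionOn (Ico 0 T) ν 0 u p → IsLerayHopfOn T ν 0 (u 0) u →
      (∀ T' < T, ∃ M : ℝ, ∀ t ∈ Icc 0 T', ∀ x, ‖u t x‖ ≤ M) →
      (∀ t ∈ Ico 0 T, IsAxisymmetric (u t)) → HasRapidSpatialDecay (u 0) →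
      ∃ (C₀ δ T₁ : ℝ) (g : ℝ → ℝ), 0 < δ ∧ 0 ≤ T₁ ∧ T₁ < T ∧
        ContinuousOn g (Ico T₁ T) ∧ MeasureTheory.IntegrableOn g (Ico T₁ T) ∧
        ∀ t ∈ Ico T₁ T, ∀ x : EuclideanSpace ℝ (Fin 3), cylRadius x < δ → cylRadius x ≠ 0 →
          x 0 * u t x 0 + x 1 * u t x 1 ≤ -(C₀ * ν) →
          fderiv ℝ (fun z : EuclideanSpace ℝ (Fin 3) => z 0 * u t z 0 + z 1 * u t z 1) x = 0 →
          0 ≤ (Δ (fun z : EuclideanSpace ℝ (Fin 3) => z 0 * u t z 0 + z 1 * u t z 1)) x →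
          -g t ≤ (u t x 0) ^ 2 + (u t x 1) ^ 2
            - (x 0 * fderiv ℝ (p t) x (EuclideanSpace.single 0 1)
                + x 1 * fderiv ℝ (p t) x (EuclideanSpace.single 1 1))) := by
  rw [axisymSwirlRegular_iff_oneSidedRadialCriterion_and_aprioriRadialInflowBound,
    oneSidedRadialCriterion_iff_corePartialTypeI, aprioriRadialInflowBound_iff_supercriticalDefectFloorGerm]

end Summit.NavierStokesRegularity.NavierStokesRegularity.Theorems.CorePartialTypeI

end
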